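import Summits.BirchSwinnertonDyer.BirchSwinnertonDyer.Theorems.ResidualThetaTransportAtTwoResidualSignedLambdaLowerCMAtTwoCofreeShapiroTransport
import Summits.BirchSwinnertonDyer.BirchSwinnertonDyer.Theorems.SchneiderFreeAdditiveX3PoitouTateUnramifiedOrthogonalAllLevels
import Summits.BirchSwinnertonDyer.BirchSwinnertonDyer.Theorems.SchneiderFreeAdditiveX3PoitouTateReciprocitySumHolds
import HarnessLib

/-!
# Greenberg LNM 1716 Lemma 4.6 on `Γ`-invariants (H46), kernel road C′, brick B4: the LEVELWISE Poitou–Tate call in the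
# Shapiro model — a layer class of `H¹(Γ_n, M)` with PRESCRIBED local classes at `S₀`, locally TRIVIAL at `S ∖ Sp` and at
# `∞`, inside an arbitrary self-controlled condition at `Sp`, unramified elsewhere — from orthogonality at `S₀` alone

Cell `bsd-2adic` (run/shared/lean/pub/bsd-2adic/), seat `bsd-2adic-tower-1` GEN 34; `--supports stmt-BirchSwinnertonDyer-19271` (helper).
THEOREMS ONLY (no definition, no named fact, no instance declaration, no `sorry`); closes no item; nothing booked; BSD is not
proved by any of this. Road C′ of `HOME/tower/gen34/NOTE-H46-ROADMAP-GEN34.md` (evidence #58 on 19271): the realiser of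
Greenberg's Lemma 4.6 at the layer `ℚ_n` is produced by ONE `selmerComplement_canonical_holds` call over `ℚ` on
`ρc := Maps(Γ_ℚ ⧸ Γ_n, M)` — the pattern of the tree's `ThetaTransport.DeepHalfLevelwiseAway.exists_admissible_prescribed_of_levelwise_orthogonal`
(RTT lineage), here with the Selmer structures the H46 programme needs:

  `𝓖 = ⊤` / `𝓕 = ⊥` at the prescribed places `S₀` (disjoint from `S`);  `𝓕 = 𝓖 = ⊥` at `S ∖ Sp` and at `∞`;
  `𝓕 = 𝓖 = Lp v` at `v ∈ Sp ⊆ S` (an ARBITRARY local condition, e.g. Greenberg's at `p`);  unramified outside `S ∪ S₀ ∪ ∞`.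

Because the places where the OUTPUT must vanish carry `⊥`, their DUAL condition is `⊤`: the orthogonality hypothesis `hT` quantifies
over layer classes `b` with NO condition at `S ∖ Sp`, `S₀`, `∞` («♭-classes»), unramified outside `S ∪ S₀`, and satisfying at
`v ∈ Sp` an arbitrary predicate `Λp v` controlled by `Lp v` through the hypothesis `hLdual` (for Greenberg's condition: the
Lagrangian self-annihilation `Literature/…/ShapiroLocalDualityOpenSubgroup`, brick B3). GENERIC: any finite discrete `Γ_ℚ`-module `M`
with a non-degenerate pairing `e : M × M → μ_N`, `N • M = 0`, any `ℤ_p`-extension `κ` of `ℚ`, any `n`.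

* `exists_layerClass_prescribed_of_orthogonal` — for prescribed local classes `t w` (`w ∈ S₀`) and the orthogonality `hT`
  («for every ♭-class `b`: `Σ_{w ∈ S₀} ⟨t w, loc_w (Ψ Sh b)⟩_w = 0`», THE canonical local Tate pairings), there is
  `c ∈ H¹(Γ_n, M)` with: `loc_w (Sh c)` unramified at every finite `w ∉ S ∪ S₀`; `loc_v (Sh c) = 0` at `v ∈ S ∖ Sp` and at every
  infinite place; `loc_v (Sh c) ∈ Lp v` at `v ∈ Sp`; `loc_w (Sh c) = t w` at `w ∈ S₀`.

For H46: `M = E[p^N]`, `e` = Weil, `S ⊇ bad ∪ {p}`, `Sp = {p}` with Greenberg's strict condition, `S₀ = {v₀}`, `t v₀ = H¹(u) z̃`; the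
`S₀`-term is `⟨z̃, loc_{v₀}(cor b)⟩_{v₀}` by `Literature/…/ContinuousShapiroLiftUnit` (brick B1) and vanishes by the universal-norm
brick B6; the output feeds B5 (realiser in `H¹(ℚ_∞, E[p^∞])`).

References: [MilneADT2006] I Cor. 2.3, Thm. 2.6, 2.13 (a), 4.10 (b); [Howard2004HeegnerKolyvagin] Thm. 2.1.11, Def. 2.1.6/2.1.10;
[NeukirchSchmidtWingberg2008] I §6 (1.6.4); [GreenbergLNM1716] §4 Lemma 4.6 (p. 105), Prop. 4.13 (p. 122).
-/

set_option autoImplicit false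
-- the Theorems namespace of this sub repeats the summit name by design (D-0017 nested layout)
set_option linter.dupNamespace false

noncomputable section

open scoped Classical

namespace Summit.BirchSwinnertonDyer.BirchSwinnertonDyer.Theorems

namespace TorsionEulerChar.H46Levelwise

open CategoryTheory Field NumberField IsDedekindDomain
  Literature.NumberTheory.EllipticCurves Literature.NumberTheory.EllipticCurves.CyclotomicLayer
  Literature.NumberTheory.EllipticCurves.GreenbergSelmer
  Literature.NumberTheory.GaloisRepresentations Literature.NumberTheory.GaloisRepresentations.DiscreteGaloisModule
  Literature.NumberTheory.GaloisCohomology ZpExtension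
open ThetaTransport.CoindShapiroOfFun (existsUnique_shapiroLift_coindTateDual_eq)
open ThetaTransport.ShapiroTransport (localization_eq_zero_of_localization_coindTateDual_eq_zero
  localization_mem_unramifiedSubgroup_of_coindTateDual)
open SignedLowerOffTwo.PTDeep (isUnramifiedAt_coind inertia_le_layerSubgroup)

variable {M : Type} [AddCommGroup M] [TopologicalSpace M] [DiscreteTopology M] [Finite M]
  (ρM : DiscreteGaloisModule ℚ M) (N : ℕ) [NeZero N]
  (e : M → M → AlgebraicClosure ℚ)
  (hμ : ∀ S T, e S T ^ N = 1)
  (hadd₁ : ∀ S₁ S₂ T, e (S₁ + S₂) T = e S₁ T * e S₂ T)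
  (hadd₂ : ∀ S T₁ T₂, e S (T₁ + T₂) = e S T₁ * e S T₂)
  (hgal : ∀ (σ : absoluteGaloisGroup ℚ) (S T : M), σ • e S T = e (ρM σ S) (ρM σ T))
  (hnondeg : ∀ T, (∀ S, e S T = 1) → T = 0) (hNM : ∀ m : M, N • m = 0)
  {p : ℕ} [Fact p.Prime] (κ : ZpExtension ℚ p) (n : ℕ) [Fintype (absoluteGaloisGroup ℚ ⧸ κ.layerSubgroup n)]
  {s : absoluteGaloisGroup ℚ ⧸ κ.layerSubgroup n → absoluteGaloisGroup ℚ}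
  (hs : ∀ x : absoluteGaloisGroup ℚ ⧸ κ.layerSubgroup n, (s x : absoluteGaloisGroup ℚ ⧸ κ.layerSubgroup n) = x)
  (hs1 : s ((1 : absoluteGaloisGroup ℚ) : absoluteGaloisGroup ℚ ⧸ κ.layerSubgroup n) = 1)
  (S Sp S₀ : Finset (HeightOneSpectrum (𝓞 ℚ))) (hSp : Sp ⊆ S) (hS₀ : Disjoint S₀ S)
  (hS : ∀ w : HeightOneSpectrum (𝓞 ℚ), w ∉ S →
    ((N : ℕ) : 𝓞 ℚ) ∉ w.asIdeal ∧ GaloisRep.IsUnramifiedAt w ρM ∧ (p : 𝓞 ℚ) ∉ w.asIdeal)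

include hnondeg hNM hSp hS₀ hS in
-- one `(n, N)`-level assembly in a single declaration, as in the RTT template: the Selmer-structure types are dear
set_option maxHeartbeats 3200000 in
/-- **Levelwise Poitou–Tate call in the Shapiro model, H46 shape.** `ρc := Maps(Γ_ℚ ⧸ Γ_n, M)`, `Ψ := coindTateDualMor` (summed
duality for `e`), `Sh := shapiroLift`. Given: local conditions `Lp v ≤ H¹(ℚ_v, ρc)` at `v ∈ Sp` with a DUAL CONTROL `hLdual` (whenever
`loc_v (Ψ Sh b)` annihilates `Lp v` under THE canonical local Tate pairing, the layer class `b` satisfies `Λp v b`); prescribed local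
classes `t w` (used at `w ∈ S₀` only); and the ORTHOGONALITY `hT`: for every layer class `b ∈ H¹(Γ_n, M)` whose Shapiro lift is unramified
at every finite `w ∉ S ∪ S₀` and which satisfies `Λp v b` at every `v ∈ Sp` — no condition at `S ∖ Sp`, `S₀`, `∞` —
`Σ_{w ∈ S₀} ⟨t w, loc_w (Ψ Sh b)⟩_w = 0`. THEN some `c ∈ H¹(Γ_n, M)` has `loc_w (Sh c)` unramified at the finite `w ∉ S ∪ S₀`, `= 0` at
`S ∖ Sp` and at `∞`, `∈ Lp v` at `Sp`, and `= t w` at `w ∈ S₀`. Proof: `SelmerComplement` (i) for THE canonical family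
(`selmerComplement_canonical_holds`) with `𝓕 ≤ 𝓖` as in the module docstring and `t` extended by `0` off `S₀`; the dual Selmer classes are
`Ψ Sh b` (`existsUnique_shapiroLift_coindTateDual_eq`), unramified where `𝓕` is (`unramifiedOrthogonal_of_isPerfect_allLevels` +
`localization_mem_unramifiedSubgroup_of_coindTateDual`), controlled at `Sp` by `hLdual`, free elsewhere (`⊥^* = ⊤`). CONDITIONAL on `hT`;
credits nothing. [cite: MilneADT2006, Ch. I, Thm. 4.10(b), Cor. 2.3, Thm. 2.6] [cite: Howard2004HeegnerKolyvagin, Thm. 2.1.11 (arXiv:1202.6340 p. 6)]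
[cite: GreenbergLNM1716, §4 Lemma 4.6 (p. 105) and Prop. 4.13 (p. 122)] -/
theorem exists_layerClass_prescribed_of_orthogonal [CompactSpace (absoluteGaloisGroup ℚ)]
    (Lp : ∀ v : HeightOneSpectrum (𝓞 ℚ),
      AddSubgroup (galoisCohomology ((ρM.coind (κ.layerSubgroup n) (κ.isOpen_layerSubgroup n)).toLocal (Sum.inr v)) 1))
    (Λp : HeightOneSpectrum (𝓞 ℚ) → H1 ρM (κ.layerSubgroup n) → Prop)
    (hLdual : ∀ v ∈ Sp, ∀ b : H1 ρM (κ.layerSubgroup n),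
      galoisCohomology.localization
          (((ρM.coind (κ.layerSubgroup n) (κ.isOpen_layerSubgroup n)).tateDual N)) (Sum.inr v) 1
          (cohomologyMap (coindTateDualMor ρM ρM (κ.layerSubgroup n) (pairingHomOfFun N e hμ hadd₁ hadd₂)
              (κ.isOpen_layerSubgroup n)
              (fun σ a b => (contPairingOfFun ρM N e hμ hadd₁ hadd₂ hgal).toLin_smul σ a b)) 1
            (shapiroLift ρM.toTopRep (κ.layerSubgroup n) (κ.isOpen_layerSubgroup n) hs hs1 b)) ∈
        (LocalInvariants.canonical ℚ N).dualLocalCondition (ρM.coind (κ.layerSubgroup n) (κ.isOpen_layerSubgroup n))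
          (Sum.inr v) (Lp v) →
      Λp v b)
    (t : ∀ w : HeightOneSpectrum (𝓞 ℚ),
      galoisCohomology ((ρM.coind (κ.layerSubgroup n) (κ.isOpen_layerSubgroup n)).toLocal (Sum.inr w)) 1)
    (hT : ∀ b : H1 ρM (κ.layerSubgroup n),
      (∀ w : HeightOneSpectrum (𝓞 ℚ), w ∉ S → w ∉ S₀ →
        galoisCohomology.localization (ρM.coind (κ.layerSubgroup n) (κ.isOpen_layerSubgroup n)) (Sum.inr w) 1
            (shapiroLift ρM.toTopRep (κ.layerSubgroup n) (κ.isOpen_layerSubgroup n) hs hs1 b) ∈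
          unramifiedSubgroup (GaloisRep.toLocal w (ρM.coind (κ.layerSubgroup n) (κ.isOpen_layerSubgroup n))) 1) →
      (∀ v ∈ Sp, Λp v b) →
      ∑ w ∈ S₀, localTatePairingZMod (ρM.coind (κ.layerSubgroup n) (κ.isOpen_layerSubgroup n)) N (Sum.inr w)
          (LocalInvariants.canonical ℚ N (Sum.inr w)) (t w)
          (galoisCohomology.localization
            (((ρM.coind (κ.layerSubgroup n) (κ.isOpen_layerSubgroup n)).tateDual N)) (Sum.inr w) 1
            (cohomologyMap (coindTateDualMor ρM ρM (κ.layerSubgroup n) (pairingHomOfFun N e hμ hadd₁ hadd₂)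
                (κ.isOpen_layerSubgroup n)
                (fun σ a b => (contPairingOfFun ρM N e hμ hadd₁ hadd₂ hgal).toLin_smul σ a b)) 1
              (shapiroLift ρM.toTopRep (κ.layerSubgroup n) (κ.isOpen_layerSubgroup n) hs hs1 b))) = 0) :
    ∃ c : H1 ρM (κ.layerSubgroup n),
      (∀ w : HeightOneSpectrum (𝓞 ℚ), w ∉ S → w ∉ S₀ →
        galoisCohomology.localization (ρM.coind (κ.layerSubgroup n) (κ.isOpen_layerSubgroup n)) (Sum.inr w) 1
            (shapiroLift ρM.toTopRep (κ.layerSubgroup n) (κ.isOpen_layerSubgroup n) hs hs1 c) ∈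
          unramifiedSubgroup (GaloisRep.toLocal w (ρM.coind (κ.layerSubgroup n) (κ.isOpen_layerSubgroup n))) 1) ∧
      (∀ v ∈ S, v ∉ Sp →
        galoisCohomology.localization (ρM.coind (κ.layerSubgroup n) (κ.isOpen_layerSubgroup n)) (Sum.inr v) 1
            (shapiroLift ρM.toTopRep (κ.layerSubgroup n) (κ.isOpen_layerSubgroup n) hs hs1 c) = 0) ∧
      (∀ w : InfinitePlace ℚ,
        galoisCohomology.localization (ρM.coind (κ.layerSubgroup n) (κ.isOpen_layerSubgroup n)) (Sum.inl w) 1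
            (shapiroLift ρM.toTopRep (κ.layerSubgroup n) (κ.isOpen_layerSubgroup n) hs hs1 c) = 0) ∧
      (∀ v ∈ Sp,
        galoisCohomology.localization (ρM.coind (κ.layerSubgroup n) (κ.isOpen_layerSubgroup n)) (Sum.inr v) 1
            (shapiroLift ρM.toTopRep (κ.layerSubgroup n) (κ.isOpen_layerSubgroup n) hs hs1 c) ∈ Lp v) ∧
      ∀ w ∈ S₀,
        galoisCohomology.localization (ρM.coind (κ.layerSubgroup n) (κ.isOpen_layerSubgroup n)) (Sum.inr w) 1
            (shapiroLift ρM.toTopRep (κ.layerSubgroup n) (κ.isOpen_layerSubgroup n) hs hs1 c) = t w := by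
  /- ### Level data -/
  have hM : ∀ m : absoluteGaloisGroup ℚ ⧸ κ.layerSubgroup n → M, N • m = 0 := fun φ => funext fun y => hNM (φ y)
  /- ### The finite set `Sfin = {∞} ∪ S ∪ S₀` and the Selmer structures `𝓕 ≤ 𝓖` on `ρc` -/
  let SF : Finset (HeightOneSpectrum (𝓞 ℚ)) := S ∪ S₀
  let Sfin : Finset (Place ℚ) := (Finset.univ : Finset (InfinitePlace ℚ)).image Sum.inl ∪ SF.image Sum.inr
  have hSinl : ∀ w : InfinitePlace ℚ, (Sum.inl w : Place ℚ) ∈ Sfin := fun w =>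
    Finset.mem_union_left _ (Finset.mem_image_of_mem _ (Finset.mem_univ w))
  have hSinr : ∀ w : HeightOneSpectrum (𝓞 ℚ), (Sum.inr w : Place ℚ) ∈ Sfin ↔ w ∈ SF := by
    intro w
    constructor
    · intro h
      rcases Finset.mem_union.mp h with h | h
      · obtain ⟨w', -, hw'⟩ := Finset.mem_image.mp h
        exact absurd hw' Sum.inl_ne_inr
      · obtain ⟨w', hw', heq⟩ := Finset.mem_image.mp h
        rw [← Sum.inr_injective heq]
        exact hw'
    · exact fun h => Finset.mem_union_right _ (Finset.mem_image_of_mem _ h)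
  have hSF : ∀ u : HeightOneSpectrum (𝓞 ℚ), u ∈ SF ↔ u ∈ S ∨ u ∈ S₀ := fun u => Finset.mem_union
  have hS₀S : ∀ u ∈ S₀, u ∉ S := fun u hu h => Finset.disjoint_left.mp hS₀ hu h
  have hSpS₀ : ∀ u ∈ Sp, u ∉ S₀ := fun u hu h => hS₀S u h (hSp hu)
  -- `𝓖`: `⊥` at `∞`; `⊤` on `S₀`; `Lp` on `Sp`; `⊥` on `S ∖ Sp`; unramified outside
  let 𝓖 : SelmerStructure (ρM.coind (κ.layerSubgroup n) (κ.isOpen_layerSubgroup n)) :=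
    fun w => match w with
      | Sum.inl _ => ⊥
      | Sum.inr u => if u ∈ S₀ then ⊤ else if u ∈ Sp then Lp u else if u ∈ S then ⊥ else
          unramifiedSubgroup (GaloisRep.toLocal u (ρM.coind (κ.layerSubgroup n) (κ.isOpen_layerSubgroup n))) 1
  -- `𝓕`: `𝓖` made `⊥` at `S₀`
  let 𝓕 : SelmerStructure (ρM.coind (κ.layerSubgroup n) (κ.isOpen_layerSubgroup n)) :=
    fun w => match w with
      | Sum.inl _ => ⊥
      | Sum.inr u => if u ∈ S₀ then ⊥ else if u ∈ Sp then Lp u else if u ∈ S then ⊥ else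
          unramifiedSubgroup (GaloisRep.toLocal u (ρM.coind (κ.layerSubgroup n) (κ.isOpen_layerSubgroup n))) 1
  have h𝓖inl : ∀ w : InfinitePlace ℚ, 𝓖 (Sum.inl w) = ⊥ := fun _ => rfl
  have h𝓕inl : ∀ w : InfinitePlace ℚ, 𝓕 (Sum.inl w) = ⊥ := fun _ => rfl
  have h𝓖S₀ : ∀ u ∈ S₀, 𝓖 (Sum.inr u) = ⊤ := fun u hu => if_pos hu
  have h𝓕S₀ : ∀ u ∈ S₀, 𝓕 (Sum.inr u) = ⊥ := fun u hu => if_pos hu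
  have h𝓖Sp : ∀ u ∈ Sp, 𝓖 (Sum.inr u) = Lp u := fun u hu =>
    (if_neg (hSpS₀ u hu)).trans (if_pos hu)
  have h𝓕Sp : ∀ u ∈ Sp, 𝓕 (Sum.inr u) = Lp u := fun u hu =>
    (if_neg (hSpS₀ u hu)).trans (if_pos hu)
  have h𝓖SS : ∀ u ∈ S, u ∉ Sp → 𝓖 (Sum.inr u) = ⊥ := fun u hu hup =>
    ((if_neg (fun h => hS₀S u h hu)).trans (if_neg hup)).trans (if_pos hu)
  have h𝓕SS : ∀ u ∈ S, u ∉ Sp → 𝓕 (Sum.inr u) = ⊥ := fun u hu hup =>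
    ((if_neg (fun h => hS₀S u h hu)).trans (if_neg hup)).trans (if_pos hu)
  have h𝓖nS : ∀ u : HeightOneSpectrum (𝓞 ℚ), u ∉ S → u ∉ S₀ → 𝓖 (Sum.inr u) =
      unramifiedSubgroup (GaloisRep.toLocal u (ρM.coind (κ.layerSubgroup n) (κ.isOpen_layerSubgroup n))) 1 :=
    fun u hu hu₀ => ((if_neg hu₀).trans (if_neg fun h => hu (hSp h))).trans (if_neg hu)
  have h𝓕nS : ∀ u : HeightOneSpectrum (𝓞 ℚ), u ∉ S → u ∉ S₀ → 𝓕 (Sum.inr u) =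
      unramifiedSubgroup (GaloisRep.toLocal u (ρM.coind (κ.layerSubgroup n) (κ.isOpen_layerSubgroup n))) 1 :=
    fun u hu hu₀ => ((if_neg hu₀).trans (if_neg fun h => hu (hSp h))).trans (if_neg hu)
  have h𝓕𝓖 : ∀ u : HeightOneSpectrum (𝓞 ℚ), u ∉ S₀ → 𝓕 (Sum.inr u) = 𝓖 (Sum.inr u) := fun u hu₀ =>
    (if_neg hu₀).trans (if_neg hu₀).symm
  have hle : 𝓕 ≤ 𝓖 := by
    intro w
    cases w with
    | inl w => rw [h𝓕inl, h𝓖inl]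
    | inr u =>
      by_cases hu : u ∈ S₀
      · rw [h𝓖S₀ u hu]; exact le_top
      · rw [h𝓕𝓖 u hu]
  have hnotSF : ∀ u : HeightOneSpectrum (𝓞 ℚ), (Sum.inr u : Place ℚ) ∉ Sfin → u ∉ S ∧ u ∉ S₀ := fun u hu =>
    ⟨fun h => hu ((hSinr u).mpr ((hSF u).mpr (Or.inl h))), fun h => hu ((hSinr u).mpr ((hSF u).mpr (Or.inr h)))⟩
  have h𝓖 : 𝓖.IsUnramifiedOutside Sfin :=
    ⟨hSinl, fun u hu => h𝓖nS u (hnotSF u hu).1 (hnotSF u hu).2⟩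
  have h𝓕 : 𝓕.IsUnramifiedOutside Sfin :=
    ⟨hSinl, fun u hu => h𝓕nS u (hnotSF u hu).1 (hnotSF u hu).2⟩
  have hS' : ∀ u : HeightOneSpectrum (𝓞 ℚ), (Sum.inr u : Place ℚ) ∉ Sfin →
      ((N : ℕ) : 𝓞 ℚ) ∉ u.asIdeal ∧
        GaloisRep.IsUnramifiedAt u (ρM.coind (κ.layerSubgroup n) (κ.isOpen_layerSubgroup n)) := by
    intro u hu
    obtain ⟨hN', hur, hup⟩ := hS u (hnotSF u hu).1
    exact ⟨hN', isUnramifiedAt_coind _ _ _ hur (inertia_le_layerSubgroup κ n hup)⟩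
  /- ### The prescribed family, extended by `0` off `S₀` -/
  let tf : ∀ v : Place ℚ, galoisCohomology
      ((ρM.coind (κ.layerSubgroup n) (κ.isOpen_layerSubgroup n)).toLocal v) 1 :=
    fun v => match v with
      | Sum.inl _ => 0
      | Sum.inr w => if w ∈ S₀ then t w else 0
  have htfinl : ∀ w : InfinitePlace ℚ, tf (Sum.inl w) = 0 := fun _ => rfl
  have htfS₀ : ∀ w ∈ S₀, tf (Sum.inr w) = t w := fun w hw => if_pos hw
  have htfnS₀ : ∀ w : HeightOneSpectrum (𝓞 ℚ), w ∉ S₀ → tf (Sum.inr w) = 0 := fun w hw => if_neg hw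
  have ht𝓖 : ∀ v ∈ Sfin, tf v ∈ 𝓖 v := by
    intro v hv
    cases v with
    | inl w => rw [htfinl]; exact zero_mem _
    | inr u =>
      by_cases hu : u ∈ S₀
      · rw [h𝓖S₀ u hu]; exact AddSubgroup.mem_top _
      · rw [htfnS₀ u hu]; exact zero_mem _
  -- the `Sfin`-sum of THE local pairings against `tf` is the `S₀`-sum against `t`
  have hsum : ∀ y : galoisCohomology
      ((ρM.coind (κ.layerSubgroup n) (κ.isOpen_layerSubgroup n)).tateDual N) 1,
      ∑ v ∈ Sfin, localTatePairingZMod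
          (ρM.coind (κ.layerSubgroup n) (κ.isOpen_layerSubgroup n)) N v
          (LocalInvariants.canonical ℚ N v) (tf v)
          (galoisCohomology.localization
            ((ρM.coind (κ.layerSubgroup n) (κ.isOpen_layerSubgroup n)).tateDual N) v 1 y) =
        ∑ w ∈ S₀, localTatePairingZMod
          (ρM.coind (κ.layerSubgroup n) (κ.isOpen_layerSubgroup n)) N (Sum.inr w)
          (LocalInvariants.canonical ℚ N (Sum.inr w)) (t w)
          (galoisCohomology.localization
            ((ρM.coind (κ.layerSubgroup n) (κ.isOpen_layerSubgroup n)).tateDual N) (Sum.inr w) 1 y) := by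
    intro y
    have hsub : S₀.image (Sum.inr : HeightOneSpectrum (𝓞 ℚ) → Place ℚ) ⊆ Sfin := fun v hv => by
      obtain ⟨w, hw, rfl⟩ := Finset.mem_image.mp hv
      exact (hSinr w).mpr ((hSF w).mpr (Or.inr hw))
    rw [← Finset.sum_subset hsub, Finset.sum_image fun a _ b _ h => Sum.inr_injective h]
    · exact Finset.sum_congr rfl fun w hw => by rw [htfS₀ w hw]
    · intro v _ hv
      cases v with
      | inl w => rw [htfinl, map_zero, AddMonoidHom.zero_apply]
      | inr u =>
        have hu : u ∉ S₀ := fun h => hv (Finset.mem_image_of_mem _ h)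
        rw [htfnS₀ u hu, map_zero, AddMonoidHom.zero_apply]
  /- ### Orthogonality of `tf` to `loc H¹_{𝓕^*}(ℚ, ρc^D)` — the transports + `hT` -/
  have horth : ∀ y ∈ ((LocalInvariants.canonical ℚ N).dualSelmerStructure
        (ρM.coind (κ.layerSubgroup n) (κ.isOpen_layerSubgroup n)) 𝓕).selmerGroup,
      ∑ v ∈ Sfin, localTatePairingZMod
          (ρM.coind (κ.layerSubgroup n) (κ.isOpen_layerSubgroup n)) N v
          (LocalInvariants.canonical ℚ N v) (tf v)
          (galoisCohomology.localization
            ((ρM.coind (κ.layerSubgroup n) (κ.isOpen_layerSubgroup n)).tateDual N) v 1 y) = 0 := by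
    intro y hy
    rw [hsum]
    -- `y = H¹(Ψ) (Sh b)`
    obtain ⟨b, hb, -⟩ := existsUnique_shapiroLift_coindTateDual_eq ρM N e hμ hadd₁ hadd₂ hgal κ hnondeg hNM n hs hs1 y
    subst hb
    have hyloc := (SelmerStructure.mem_selmerGroup_iff _ _).mp hy
    -- [unr] outside `S ∪ S₀`
    have hunr : ∀ w : HeightOneSpectrum (𝓞 ℚ), w ∉ S → w ∉ S₀ →
        galoisCohomology.localization (ρM.coind (κ.layerSubgroup n) (κ.isOpen_layerSubgroup n)) (Sum.inr w) 1
            (shapiroLift ρM.toTopRep (κ.layerSubgroup n) (κ.isOpen_layerSubgroup n) hs hs1 b) ∈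
          unramifiedSubgroup (GaloisRep.toLocal w (ρM.coind (κ.layerSubgroup n) (κ.isOpen_layerSubgroup n))) 1 := by
      intro w hwS hw₀
      have hwSF : (Sum.inr w : Place ℚ) ∉ Sfin := fun h =>
        ((hSF w).mp ((hSinr w).mp h)).elim hwS hw₀
      have h1 := hyloc (Sum.inr w)
      rw [LocalInvariants.dualSelmerStructure_apply, h𝓕nS w hwS hw₀,
        (SchneiderFreeAdditiveX3.PoitouTateReduction.unramifiedOrthogonal_of_isPerfect_allLevels
          (LocalInvariants.canonical ℚ N) LocalInvariants.canonical_isPerfect _ hM w (hS' w hwSF).1 (hS' w hwSF).2).1] at h1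
      exact localization_mem_unramifiedSubgroup_of_coindTateDual ρM N e hμ hadd₁ hadd₂ hgal (κ.layerSubgroup n)
        (κ.isOpen_layerSubgroup n) hnondeg hNM w _ h1
    -- [Sp] the controlled condition
    have hΛ : ∀ v ∈ Sp, Λp v b := by
      intro v hv
      have h1 := hyloc (Sum.inr v)
      rw [LocalInvariants.dualSelmerStructure_apply, h𝓕Sp v hv] at h1
      exact hLdual v hv b h1
    exact hT b hunr hΛ
  /- ### `SelmerComplement` (i) for THE canonical family, and the output class `c = Sh⁻¹ x` -/
  obtain ⟨x, hx𝓖, hxloc⟩ :=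
    (SchneiderFreeAdditiveX3.PoitouTateReduction.selmerComplement_canonical_holds (K := ℚ) N _ hM Sfin hS' 𝓕 𝓖 hle h𝓕 h𝓖).1
      tf ht𝓖 horth
  obtain ⟨c, hc⟩ := shapiroLift_surjective ρM.toTopRep (κ.layerSubgroup n) (κ.isOpen_layerSubgroup n) hs hs1 x
  have hXloc := (SelmerStructure.mem_selmerGroup_iff _ _).mp hx𝓖
  refine ⟨c, fun w hwS hw₀ => ?_, fun v hv hvp => ?_, fun w => ?_, fun v hv => ?_, fun w hw => ?_⟩
  · -- unramified outside `S ∪ S₀`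
    have hwSF : (Sum.inr w : Place ℚ) ∉ Sfin := fun h => ((hSF w).mp ((hSinr w).mp h)).elim hwS hw₀
    have h1 := hXloc (Sum.inr w)
    rw [h𝓖.2 w hwSF, ← hc] at h1
    exact h1
  · -- strict at `S ∖ Sp`
    have h1 := hXloc (Sum.inr v)
    rw [h𝓖SS v hv hvp, ← hc] at h1
    exact (AddSubgroup.mem_bot).mp h1
  · -- strict at `∞`
    have h1 := hXloc (Sum.inl w)
    rw [h𝓖inl w, ← hc] at h1
    exact (AddSubgroup.mem_bot).mp h1
  · -- inside `Lp v` at `Sp`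
    have h1 := hXloc (Sum.inr v)
    rw [h𝓖Sp v hv, ← hc] at h1
    exact h1
  · -- prescribed at `S₀`
    have h1 := hxloc (Sum.inr w) ((hSinr w).mpr ((hSF w).mpr (Or.inr hw)))
    rw [h𝓕S₀ w hw, htfS₀ w hw, ← hc] at h1
    exact sub_eq_zero.mp ((AddSubgroup.mem_bot).mp h1)

end TorsionEulerChar.H46Levelwise

end Summit.BirchSwinnertonDyer.BirchSwinnertonDyer.Theorems

end
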